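import Literature.Analysis.FluidPDE.SereginSverakBlowupCore
import Literature.Analysis.FluidPDE.SereginSverakRescaledHypotheses
import HarnessLib

/-!
# Seregin–Šverák 2009, §4 for Theorem 3.2: Lemma 3.6 and the original blow-up alternative

G. Seregin, V. Šverák, *On Type I singularities of the local axi-symmetric solutions of the
Navier–Stokes equations*, Comm. PDE 34 (2009) = arXiv:0804.1803 (arXiv pagination). Companion
of `SereginSverakBlowup` / `SereginSverakBlowupProofs`. There the blow-up step of §4 was reduced,
under the Type I hypothesis (r3) of Thm. 3.1, to the two analytic inputs `InteriorContinuity`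
and `BlowupCompactness`. This file does the same for the hypotheses of **Theorem 3.2** — (r2)
`v ∈ L_∞(𝒞 × ]-1,-a²[)` and (r4) `|v| ≤ C/|x'|` a.e. in `Q` — and thereby for the accepted
named fact `SereginSverak2009.BlowupAlternative` (whose hypotheses contain those of Thm. 3.2
after a zoom; see the module docstring of `SereginSverakBlowup` for why its origin-centred (p1)
cannot be used and is not used).

The third input is **Lemma 3.6** (arXiv p. 10): "Under assumptions of Theorem 3.2, estimate
(as4) [`A(z_b,r;v) + E(z_b,r;v) + C(z_b,r;v) + D(z_b,r;q) ≤ C₁` for all `z_b = (b e₃, 0)`,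
`|b| ≤ 1/4`, `0 < r < 1/4`] is valid as well with constant `C₁` depending only on the constant
`C` in (r4), `‖v‖_{L³(Q)}`, and `‖q‖_{L^{3/2}(Q)}`", vendored as the named fact
`ScaledEnergyBound36` WITH the uniformity of its constant (the shape in which §4's "scaling
arguments" consume it: one `C₁` for all pairs whose three quantities are bounded by given
numbers). From it, the pressure bound at the moving blow-up centres `(x_{k,3} e₃, t_k)` is
obtained by the time-shift-and-zoom `(s, y) ↦ (t_k + θ² s, θ y)`, `θ = 1/2`, which preserves the
hypotheses of Thm. 3.2 with controlled norms, followed by the scale invariance of `D`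
(`pressureD_shift_rescale`): `D((t_k, b' e₃), r'; q) ≤ C₁` for `|b'| ≤ 1/8`, `0 < r' < 1/8`, all `k`.
The rest is the selection-and-rescaling core `blowup_of_centres` of `SereginSverakBlowupCore`
(the Type I reduction through the same steps is `SereginSverakBlowupProofs`).

## Contents

* `ScaledEnergyBound36` — Lemma 3.6, named fact (uniform constant).
* `pressureD_le_of_bound36` — the pressure bound at all axis centres near the origin, from
  Lemma 3.6 by shift-and-zoom (the transport of the hypotheses of Thms. 3.1–3.2 under
  `(s, y) ↦ (t₀ + c² s, c y)` is proved in `SereginSverakRescaledHypotheses`).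
* `blowup_of_decay` — §4 for Thm. 3.2 from `ScaledEnergyBound36`, `InteriorContinuity`,
  `BlowupCompactness` (proved); `isRegularAtOrigin_of_decay` — Thm. 3.2 assembled with
  KNSS 2009, Thm. 5.3 (proved); `blowupAlternative_of_facts :
  ScaledEnergyBound36 → InteriorContinuity → BlowupCompactness → BlowupAlternative` (proved),
  which exhibits exactly what a discharge of the accepted `BlowupAlternative` requires;
  `blowupAlternativeTypeI_of_blowupAlternative : BlowupAlternative → BlowupAlternativeTypeI`
  (the corrected fact is the weaker proposition).

## References

* G. Seregin, V. Šverák, Comm. PDE 34 (2009), arXiv:0804.1803: §3 p. 9 (Thm. 3.2 (rt2),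
  (r2), (r4), Lemma 3.3, Remark 3.4), p. 10 (Lemma 3.6 (asl5)), §4 p. 11. [`SereginSverak2009`]
* G. Koch, N. Nadirashvili, G. Seregin, V. Šverák, Acta Math. 203 (2009), Thm. 5.3.
  [`KochNadirashviliSereginSverak2009`]
-/

noncomputable section

open MeasureTheory Set Function Filter Topology TopologicalSpace Module
open scoped NNReal ENNReal

namespace Literature.Analysis.FluidPDE

namespace SereginSverak2009

/-- Local notation for physical space `ℝ³ = EuclideanSpace ℝ (Fin 3)`. -/
local notation "ℝ³" => EuclideanSpace ℝ (Fin 3)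

/-! ### Lemma 3.6 as a named fact -/

/-- **Seregin–Šverák 2009, Lemma 3.6** (arXiv p. 10: "Under assumptions of Theorem 3.2,
estimate (as4) is valid as well with constant `C₁` depending only on the constant `C` in (r4),
`‖v‖_{L³(Q)}`, and `‖q‖_{L^{3/2}(Q)}`"; (as4)–(as5): `A(z_b,r;v) + E(z_b,r;v) + C(z_b,r;v) +
D(z_b,r;q) ≤ C₁ < +∞` for all `z_b = (b e₃, 0)`, `b ∈ ℝ`, `|b| ≤ 1/4`, `0 < r < 1/4`; "proved in
the same way as Lemma 3.5 and even easier because main inequality (as11) can be established with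
the help of the case `s = s₁`, `l = l₁` only"). The assumptions of Thm. 3.2 are the standing ones
of §3 with axial symmetry (`IsAxisymmetricLocalSolution`), (r2) (`IsBoundedAwayFromZero`) and
(r4) `|v(x,t)| ≤ C/|x'|` a.e. in `Q`, rendered junk-free as `|x'| ‖u‖ ≤ C` a.e. on `Q`. As in
`ScaledEnergyBound`, `E` is computed through a weak spatial gradient `G = ∇v ∈ L²_loc(Q)` provided
by the fact (Remark 3.4). The dependence "only on `C`, `‖v‖_{L³(Q)}`, `‖q‖_{L^{3/2}(Q)}`" is
rendered as uniformity: for all numbers `C, N₁, N₂` there is one `C₁` valid for every pair with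
`|x'| ‖u‖ ≤ C` a.e., `∫_Q |u|³ ≤ N₁`, `∫_Q |p|^{3/2} ≤ N₂` (the form in which §4's "scaling
arguments" use the lemma under time shifts and zooms).
[cite: SereginSverak2009, Lemma 3.6 (asl5) with (as4)–(as5) and Remark 3.4 (arXiv pp. 9–10)] -/
def ScaledEnergyBound36 : Prop :=
  ∀ C N₁ N₂ : ℝ, ∃ C₁ : ℝ≥0, ∀ (u : ℝ → ℝ³ → ℝ³) (p : ℝ → ℝ³ → ℝ),
    IsAxisymmetricLocalSolution u p → IsBoundedAwayFromZero u →
    (∀ᵐ z ∂(volume.restrict (parCyl 0 1)), cylRadius z.2 * ‖u z.1 z.2‖ ≤ C) →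
    (∫⁻ z in parCyl 0 1, ‖u z.1 z.2‖ₑ ^ (3 : ℕ) ≤ ENNReal.ofReal N₁) →
    (∫⁻ z in parCyl 0 1, ‖p z.1 z.2‖ₑ ^ (3 / 2 : ℝ) ≤ ENNReal.ofReal N₂) →
    ∃ G : ℝ → ℝ³ → ℝ³ →L[ℝ] ℝ³, HasWeakSpatialGradientOn (parCylOpens 0 1) u G ∧
      ∀ b : ℝ, |b| ≤ 1 / 4 → ∀ r ∈ Ioo (0 : ℝ) (1 / 4),
        energyA ((0 : ℝ), b • eZ) r u + dissipationE ((0 : ℝ), b • eZ) r G +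
          cubicC ((0 : ℝ), b • eZ) r u + pressureD ((0 : ℝ), b • eZ) r p ≤ C₁

/-! ### §4 for Theorem 3.2 -/

/-- **The pressure bound at all axis centres near the origin, from Lemma 3.6 by time shift and
zoom.** Under the hypotheses of Thm. 3.2, with `C₁` the constant of `ScaledEnergyBound36` for
`(C, 4‖u‖³_{L³(Q)}, 4‖p‖^{3/2}_{L^{3/2}(Q)})`: `D((t₀, b' e₃), r'; p) ≤ C₁` for all
`-3/4 ≤ t₀ ≤ 0`, `|b'| ≤ 1/8`, `0 < r' < 1/8` (apply Lemma 3.6 to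
`(u, p) ∘ (t₀ + s/4, y/2)`, rescaled, and undo the scaling in `D`).
[cite: SereginSverak2009, Lemma 3.6 and §4 ("scaling arguments", arXiv pp. 10–11)] -/
theorem pressureD_le_of_bound36 {u : ℝ → ℝ³ → ℝ³} {p : ℝ → ℝ³ → ℝ} {C : ℝ} {C₁ : ℝ≥0}
    (hC₁ : ∀ (u' : ℝ → ℝ³ → ℝ³) (p' : ℝ → ℝ³ → ℝ),
      IsAxisymmetricLocalSolution u' p' → IsBoundedAwayFromZero u' →
      (∀ᵐ z ∂(volume.restrict (parCyl 0 1)), cylRadius z.2 * ‖u' z.1 z.2‖ ≤ C) →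
      (∫⁻ z in parCyl 0 1, ‖u' z.1 z.2‖ₑ ^ (3 : ℕ) ≤
        ENNReal.ofReal (ENNReal.ofReal ((1 / 2 : ℝ) ^ 2)⁻¹ *
          ∫⁻ z in parCyl 0 1, ‖u z.1 z.2‖ₑ ^ (3 : ℕ)).toReal) →
      (∫⁻ z in parCyl 0 1, ‖p' z.1 z.2‖ₑ ^ (3 / 2 : ℝ) ≤
        ENNReal.ofReal (ENNReal.ofReal ((1 / 2 : ℝ) ^ 2)⁻¹ *
          ∫⁻ z in parCyl 0 1, ‖p z.1 z.2‖ₑ ^ (3 / 2 : ℝ)).toReal) →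
      ∃ G : ℝ → ℝ³ → ℝ³ →L[ℝ] ℝ³, HasWeakSpatialGradientOn (parCylOpens 0 1) u' G ∧
        ∀ b : ℝ, |b| ≤ 1 / 4 → ∀ r ∈ Ioo (0 : ℝ) (1 / 4),
          energyA ((0 : ℝ), b • eZ) r u' + dissipationE ((0 : ℝ), b • eZ) r G +
            cubicC ((0 : ℝ), b • eZ) r u' + pressureD ((0 : ℝ), b • eZ) r p' ≤ C₁)
    (hsol : IsAxisymmetricLocalSolution u p) (hr2 : IsBoundedAwayFromZero u)
    (hr4 : ∀ᵐ z ∂(volume.restrict (parCyl 0 1)), cylRadius z.2 * ‖u z.1 z.2‖ ≤ C)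
    {t₀ b' r' : ℝ} (ht₀ : t₀ ≤ 0) (ht₁ : -3 / 4 ≤ t₀) (hb' : |b'| ≤ 1 / 8)
    (hr' : r' ∈ Ioo (0 : ℝ) (1 / 8)) :
    pressureD (t₀, b' • eZ) r' p ≤ C₁ := by
  have hθ : (0 : ℝ) < 1 / 2 := by norm_num
  have hθ1 : (1 / 2 : ℝ) ≤ 1 := by norm_num
  have ht₁' : -1 ≤ t₀ - (1 / 2 : ℝ) ^ 2 := by linarith
  set U := (1 / 2 : ℝ) • stPull ((1 / 2 : ℝ) ^ 2) (1 / 2) t₀ ((0 : ℝ) • eZ) u with hU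
  set P := (1 / 2 : ℝ) ^ 2 • stPull ((1 / 2 : ℝ) ^ 2) (1 / 2) t₀ ((0 : ℝ) • eZ) p with hP
  have hsolU : IsAxisymmetricLocalSolution U P := isAxisymmetricLocalSolution_rescale hsol hθ hθ1 ht₀ ht₁'
  have hr2U : IsBoundedAwayFromZero U := isBoundedAwayFromZero_rescale hr2 hθ hθ1 ht₀ ht₁'
  have hr4U : ∀ᵐ z ∂(volume.restrict (parCyl 0 1)), cylRadius z.2 * ‖U z.1 z.2‖ ≤ C :=
    ae_decay_rescale hθ hr4 (parCyl_one_subset_preimage hθ hθ1 ht₀ ht₁')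
  have hN₁ : ∫⁻ z in parCyl 0 1, ‖U z.1 z.2‖ₑ ^ (3 : ℕ) ≤
      ENNReal.ofReal (ENNReal.ofReal ((1 / 2 : ℝ) ^ 2)⁻¹ *
        ∫⁻ z in parCyl 0 1, ‖u z.1 z.2‖ₑ ^ (3 : ℕ)).toReal := by
    rw [ENNReal.ofReal_toReal (ENNReal.mul_ne_top ENNReal.ofReal_ne_top hsol.velocity_L3.ne)]
    exact lintegral_velocity_rescale hθ hθ1 ht₀ ht₁'
  have hN₂ : ∫⁻ z in parCyl 0 1, ‖P z.1 z.2‖ₑ ^ (3 / 2 : ℝ) ≤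
      ENNReal.ofReal (ENNReal.ofReal ((1 / 2 : ℝ) ^ 2)⁻¹ *
        ∫⁻ z in parCyl 0 1, ‖p z.1 z.2‖ₑ ^ (3 / 2 : ℝ)).toReal := by
    rw [ENNReal.ofReal_toReal (ENNReal.mul_ne_top ENNReal.ofReal_ne_top hsol.pressure_L32.ne)]
    exact lintegral_pressure_rescale hθ hθ1 ht₀ ht₁'
  obtain ⟨G, -, hG⟩ := hC₁ U P hsolU hr2U hr4U hN₁ hN₂
  -- Lemma 3.6 for the shifted pair at `b = 2 b'`, `r = 2 r'`, and scale invariance of `D`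
  have hb : |2 * b'| ≤ 1 / 4 := by rw [abs_mul, abs_two]; linarith
  have hr : 2 * r' ∈ Ioo (0 : ℝ) (1 / 4) := ⟨by linarith [hr'.1], by linarith [hr'.2]⟩
  have h1 : pressureD ((0 : ℝ), (2 * b') • eZ) (2 * r') P ≤ C₁ :=
    (pressureD_le_sum _ _ U G P).trans (hG _ hb _ hr)
  have e : pressureD ((0 : ℝ), (2 * b') • eZ) (2 * r') P = pressureD (t₀, b' • eZ) r' p := by
    have h2 := pressureD_shift_rescale (c := 1 / 2) (r := r') hθ hr'.1 t₀ ((0 : ℝ) • eZ)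
      ((2 * b') • eZ) p
    rw [show r' / (1 / 2 : ℝ) = 2 * r' by ring] at h2
    rw [hP, h2]
    congr 2
    rw [smul_smul, ← add_smul]
    congr 1
    ring
  rwa [e] at h1

/-- **Seregin–Šverák 2009, §4 for Theorem 3.2, from Lemma 3.6 and the two analytic inputs.**
Under the hypotheses of Thm. 3.2 (standing assumptions with axial symmetry, (r2), (r4) on `Q`),
if `z = 0` is singular then there is a bounded ancient weak solution in the class of KNSS,
axisymmetric, with `|y'| ‖w‖ ≤ C` a.e. and not a.e. zero. Proof: the core `blowup_of_centres`
with the pressure bound at the moving centres supplied by `pressureD_le_of_bound36`.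
[cite: SereginSverak2009, §4 (proof of Thm. 3.2, arXiv p. 11) with Lemma 3.6] -/
theorem blowup_of_decay (h36 : ScaledEnergyBound36) (hF1 : InteriorContinuity)
    (hF2 : BlowupCompactness) {u : ℝ → ℝ³ → ℝ³} {p : ℝ → ℝ³ → ℝ}
    (hsol : IsAxisymmetricLocalSolution u p) (hr2 : IsBoundedAwayFromZero u) {C : ℝ}
    (hr4 : ∀ᵐ z ∂(volume.restrict (parCyl 0 1)), cylRadius z.2 * ‖u z.1 z.2‖ ≤ C)
    (hsing : ¬ IsRegularAtOrigin u) :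
    ∃ w : ℝ → ℝ³ → ℝ³, IsBoundedWeakNSSolutionOn (Iio 0) isOpen_Iio 1 w ∧
      (∀ θ : ℝ, ∀ᵐ t ∂(volume.restrict (Iio (0 : ℝ))),
        (fun x => w t (rotZ θ x)) =ᵐ[volume] fun x => rotZ θ (w t x)) ∧
      (∀ᵐ t ∂(volume.restrict (Iio (0 : ℝ))), ∀ᵐ x ∂(volume : Measure ℝ³),
        cylRadius x * ‖w t x‖ ≤ C) ∧
      ¬ (∀ᵐ t ∂(volume.restrict (Iio (0 : ℝ))), w t =ᵐ[volume] 0) := by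
  obtain ⟨v, hvc, hvu⟩ := hF1 u p hsol.distributional hsol.velocity_L3 hsol.pressure_L32 hr2
  have h18 : parCyl (0 : ℝ × ℝ³) (1 / 8) ⊆ parCyl 0 1 := parCyl_mono 0 (by norm_num) (by norm_num)
  have hC₂ : ∀ᵐ z ∂(volume.restrict (parCyl 0 (1 / 8))), cylRadius z.2 * ‖u z.1 z.2‖ ≤ C :=
    ae_restrict_of_ae_restrict_of_subset h18 hr4
  have hp2v : ∀ z ∈ parCyl 0 (1 / 8), cylRadius z.2 * ‖v z‖ ≤ C :=
    forall_mul_norm_le_of_ae (isOpen_parCyl 0 (1 / 8))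
      (continuous_cylRadius.comp continuous_snd).continuousOn (hvc.mono h18)
      (ae_restrict_of_ae_restrict_of_subset h18 hvu) hC₂
  set C₂' : ℝ := max C 0 with hC₂'
  have hC₂'0 : 0 ≤ C₂' := le_max_right _ _
  have hC₂le : C ≤ C₂' := le_max_left _ _
  -- the near-maximum centres
  have hsel := fun k : ℕ =>
    exists_centre hvc hvu hsing (N := 4 * C₂' + k + 1) (by positivity)
  choose zc d hzQ hz3 hdpos hdle hN hbd hback using hsel
  -- Lemma 3.6, uniform constant for the shifted pairs
  obtain ⟨C₁, hC₁⟩ := h36 C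
    (ENNReal.ofReal ((1 / 2 : ℝ) ^ 2)⁻¹ * ∫⁻ z in parCyl 0 1, ‖u z.1 z.2‖ₑ ^ (3 : ℕ)).toReal
    (ENNReal.ofReal ((1 / 2 : ℝ) ^ 2)⁻¹ * ∫⁻ z in parCyl 0 1, ‖p z.1 z.2‖ₑ ^ (3 / 2 : ℝ)).toReal
  -- the pressure bound at the moving centres
  have hpress : ∀ a : ℝ, 0 < a → ∃ cst : ℝ≥0, ∀ᶠ k : ℕ in atTop,
      ∫⁻ z in parCyl 0 a, ‖((1 / (2 * ‖v (zc k)‖)) ^ 2 •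
        stPull ((1 / (2 * ‖v (zc k)‖)) ^ 2) (1 / (2 * ‖v (zc k)‖)) (zc k).1 ((zc k).2 2 • eZ) p)
          z.1 z.2‖ₑ ^ (3 / 2 : ℝ) ≤ cst := by
    intro a ha
    refine ⟨(a ^ 2).toNNReal * C₁, ?_⟩
    filter_upwards [eventually_ge_atTop (Nat.ceil (a ^ 2))] with k hk
    have hk' : a ^ 2 ≤ (k : ℝ) + 1 :=
      ((Nat.le_ceil _).trans (by exact_mod_cast hk)).trans (le_add_of_nonneg_right zero_le_one)
    set Mk := ‖v (zc k)‖ with hMk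
    set ck := 1 / (2 * Mk) with hck
    have hNk : (k : ℝ) + 1 ≤ Mk * d k := by
      have := hN k
      linarith
    have hMpos : 0 < Mk := by
      by_contra h
      push Not at h
      have h2 : Mk * d k ≤ 0 := mul_nonpos_of_nonpos_of_nonneg h (hdpos k).le
      have h3 : (0 : ℝ) ≤ k := Nat.cast_nonneg k
      linarith
    have hcpos : 0 < ck := by positivity
    have htk : (zc k).1 ≤ 0 := ((mem_parCyl_zero.1 (hzQ k)).1.2).le
    have htk' : -(1 / 8 : ℝ) ^ 2 < (zc k).1 := (mem_parCyl_zero.1 (hzQ k)).1.1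
    have hac2 : (a * ck) ^ 2 ≤ 1 / 400 := scale_sq_le (hdpos k) (hdle k) hNk hk' ha.le
    have hac : 0 < a * ck := mul_pos ha hcpos
    have haclt : a * ck < 1 / 8 := by nlinarith
    have hb : |(zc k).2 2| ≤ 1 / 8 := (hz3 k).trans (by norm_num)
    have hD : pressureD ((zc k).1, (zc k).2 2 • eZ) (a * ck) p ≤ C₁ :=
      pressureD_le_of_bound36 hC₁ hsol hr2 hr4 htk (by linarith) hb ⟨hac, haclt⟩
    have key := lintegral_pressure_rescaled_of_pressureD (x₀ := (zc k).2 2 • eZ)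
      (tk := (zc k).1) hcpos ha hD
    refine key.trans_eq ?_
    rw [ENNReal.coe_mul, ENNReal.ofReal]
  exact blowup_of_centres hF2 hsol hvc hvu hC₂ hp2v hC₂le hC₂'0 hzQ hdpos hN hbd hback hpress

/-- **Seregin–Šverák 2009, Theorem 3.2, assembled** (arXiv p. 9: axially symmetric weak
solution in `Q` with `v ∈ L³(Q)`, `q ∈ L^{3/2}(Q)`, (r2) `v ∈ L_∞(𝒞 × ]-1,-a²[)` for each
`0 < a < 1`, and (r4) `|v| ≤ C/|x'|` a.e. in `Q`; then `z = 0` is a regular point), from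
Lemma 3.6 (`ScaledEnergyBound36`), `InteriorContinuity`, `BlowupCompactness` and KNSS 2009,
Thm. 5.3 (`KNSS2009_liouville_bound_C_over_r`), as in §4. [cite: SereginSverak2009, Thm. 3.2 and §4] -/
theorem isRegularAtOrigin_of_decay (h36 : ScaledEnergyBound36) (hF1 : InteriorContinuity)
    (hF2 : BlowupCompactness) (h53 : KNSS2009_liouville_bound_C_over_r) {u : ℝ → ℝ³ → ℝ³}
    {p : ℝ → ℝ³ → ℝ} (hsol : IsAxisymmetricLocalSolution u p) (hr2 : IsBoundedAwayFromZero u)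
    (hr4 : ∃ C : ℝ, ∀ᵐ z ∂(volume.restrict (parCyl 0 1)), cylRadius z.2 * ‖u z.1 z.2‖ ≤ C) :
    IsRegularAtOrigin u := by
  by_contra hsing
  obtain ⟨C, hC⟩ := hr4
  obtain ⟨w, hw, haxi, hdecay, hne⟩ := blowup_of_decay h36 hF1 hF2 hsol hr2 hC hsing
  exact hne (h53 hw haxi ⟨C, hdecay⟩)

/-! ### The accepted `BlowupAlternative`, reduced to the three facts -/

/-- **Discharge of `BlowupAlternative` relative to Lemma 3.6 and the two analytic inputs.**
The accepted fact `BlowupAlternative` (hypotheses: standing assumptions with axial symmetry,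
(r2), the origin-centred local (p1) — not used —, the local (p2) `|x'| ‖u‖ ≤ A₂` a.e. on some
`Q(ρ)`, and "`z = 0` singular") follows from `ScaledEnergyBound36`, `InteriorContinuity` and
`BlowupCompactness`: zoom `Q(ρ)` to `Q` (`isAxisymmetricLocalSolution_rescale`,
`isBoundedAwayFromZero_rescale`, `ae_decay_rescale`, `isRegularAtOrigin_of_rescale`), which
puts us under the hypotheses of Thm. 3.2 with a singular origin, and apply `blowup_of_decay`.
[cite: SereginSverak2009, §4 (proof of Thms. 3.1–3.2, arXiv p. 11) with Lemma 3.6] -/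
theorem blowupAlternative_of_facts (h36 : ScaledEnergyBound36) (hF1 : InteriorContinuity)
    (hF2 : BlowupCompactness) : BlowupAlternative := by
  intro u p hsol hr2 _ hp2 hsing
  obtain ⟨ρ, hρ, A₂, hA₂⟩ := hp2
  have hρ0 : 0 < ρ := hρ.1
  have hρ1 : ρ ≤ 1 := hρ.2
  have ht₁ : -1 ≤ (0 : ℝ) - ρ ^ 2 := by nlinarith
  set U := ρ • stPull (ρ ^ 2) ρ 0 ((0 : ℝ) • eZ) u with hU
  set P := ρ ^ 2 • stPull (ρ ^ 2) ρ 0 ((0 : ℝ) • eZ) p with hP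
  have hsolU : IsAxisymmetricLocalSolution U P :=
    isAxisymmetricLocalSolution_rescale hsol hρ0 hρ1 le_rfl ht₁
  have hr2U : IsBoundedAwayFromZero U := isBoundedAwayFromZero_rescale hr2 hρ0 hρ1 le_rfl ht₁
  have hmaps : parCyl (0 : ℝ × ℝ³) 1 ⊆ stAffine (ρ ^ 2) ρ 0 ((0 : ℝ) • eZ) ⁻¹' parCyl 0 ρ := by
    have h1 : stAffine (ρ ^ 2) ρ 0 ((0 : ℝ) • eZ) ⁻¹' parCyl ((0 : ℝ), (0 : ℝ) • eZ) ρ =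
        parCyl 0 1 := by
      rw [stAffine_preimage_parCyl hρ0, div_self hρ0.ne']
    rw [prod_zero_zero_smul_eZ] at h1
    rw [h1]
  have hr4U : ∀ᵐ z ∂(volume.restrict (parCyl 0 1)), cylRadius z.2 * ‖U z.1 z.2‖ ≤ A₂ :=
    ae_decay_rescale hρ0 hA₂ hmaps
  have hsingU : ¬ IsRegularAtOrigin U := fun h => hsing (isRegularAtOrigin_of_rescale hρ0 h)
  obtain ⟨w, hw, haxi, hdecay, hne⟩ := blowup_of_decay h36 hF1 hF2 hsolU hr2U hr4U hsingU
  exact ⟨w, hw, haxi, ⟨A₂, hdecay⟩, hne⟩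

/-- **The accepted fact implies the corrected one**: the hypotheses of `BlowupAlternativeTypeI`
(Type I (r3), the printed outputs of Lemma 3.5 and Prop. 3.7) imply those of `BlowupAlternative`
((r2) by `isBoundedAwayFromZero_of_isTypeIOnCyl`, the origin-centred local (p1) on `]0, 1/8]`
from Lemma 3.5 at `b = 0`, the local (p2) on `Q(1/8)`), and the conclusions coincide; so the
corrected fact is the weaker proposition (as the reviewer of `SereginSverakBlowup` observed).
[cite: SereginSverak2009, §4 (arXiv p. 11)] -/
theorem blowupAlternativeTypeI_of_blowupAlternative (h : BlowupAlternative) :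
    BlowupAlternativeTypeI := by
  intro u p hsol hI h35 h37 hsing
  obtain ⟨G, hG, C₁, hC₁⟩ := h35
  have hp1 : ∃ G : ℝ → ℝ³ → ℝ³ →L[ℝ] ℝ³, HasWeakSpatialGradientOn (parCylOpens 0 1) u G ∧
      ∃ ρ ∈ Ioc (0 : ℝ) 1, ∃ A₁ : ℝ≥0, ∀ r ∈ Ioc (0 : ℝ) ρ,
        energyA 0 r u + dissipationE 0 r G + cubicC 0 r u + pressureD 0 r p ≤ A₁ := by
    refine ⟨G, hG, 1 / 8, ⟨by norm_num, by norm_num⟩, C₁, fun r hr => ?_⟩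
    have hr' : r ∈ Ioo (0 : ℝ) (1 / 4) := ⟨hr.1, by linarith [hr.2]⟩
    have key := hC₁ 0 (by norm_num) r hr'
    simpa only [zero_smul, Prod.mk_zero_zero] using key
  have hp2 : ∃ ρ ∈ Ioc (0 : ℝ) 1, ∃ A₂ : ℝ,
      ∀ᵐ z ∂(volume.restrict (parCyl 0 ρ)), cylRadius z.2 * ‖u z.1 z.2‖ ≤ A₂ :=
    ⟨1 / 8, ⟨by norm_num, by norm_num⟩, h37⟩
  exact h u p hsol (isBoundedAwayFromZero_of_isTypeIOnCyl hI) hp1 hp2 hsing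

end SereginSverak2009

end Literature.Analysis.FluidPDE
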